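import Summits.BirchSwinnertonDyer.BirchSwinnertonDyer.Theorems.AlignedTransportAtTwoMainConjectureOfRankZeroBSDAtTwoSelmerLayerControl
import Literature.NumberTheory.EllipticCurves.ZpCorankCyclotomicDivisibility
import HarnessLib

/-!
# Route `AlignedTransportAtTwo`, crux C2 `MainConjectureOfRankZeroBSDAtTwo` (stmt-BirchSwinnertonDyer-22298):
# THE LAYER SPLIT — `corank_{ℤ_p} Sel_∞^{Γ_{n+1}} = corank_{ℤ_p} Sel_∞^{Γ_n} + rank_{ℤ_p} X/Ψ_{n+1}X`
# (`Ψ_{n+1} = Φ_{p^{n+1}}(1+T) = ∑_{i<p} (1+T)^{pⁿ i}`, every prime `p`, every number field, every `ℤ_p`-extension, every `n`),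
# hence `rank X/ω_{n+1}X = rank X/ω_nX + rank X/Ψ_{n+1}X`, and THE LAYER-`n` MATCHING LAW IN CORANK FORM:
# `corank Sel_{p^∞}(E_{K_{n+1}}/K_{n+1}) − corank Sel_{p^∞}(E_{K_n}/K_n) = rank_{ℤ_p} X/Ψ_{n+1}X` modulo the finiteness of `ker g` at the two layers

HONEST FRAMING (cell `bsd-f1-sign2`, WIDTH-5 attached prover seat `bsd-line-att-p5` gen 40 on line `birth` of the lead
`bsd-line-att-p2`; `--supports` stmt-BirchSwinnertonDyer-22298, closes nothing; BSD is NOT proved by any of this; the crux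
C2, its verdict «blocked-on `Rank1Residual.GreenbergMuConjectureIrreducible`» and every registered stub are untouched).
THEOREMS ONLY — no `def`, no instance, no named fact, no `sorry`. General-`p` sequel of `…SelmerLayerTwoSidedMatching` §1
(there `p = 2`, `n = 0`: the involution split) and of g36/g37's cyclotomic-layer RANK program (`…CyclotomicLayerRank*`:
`Ψ_n ∣ f_X` from a Mordell–Weil jump): here the jump is measured on SELMER coranks (Ш counts) and EXACTLY, on the dual side.

* §1 (pure algebra: an abelian `p`-primary group `S`, an endomorphism `ψ`) ★★ `zpCorank_endInvariants_pow_sub_one_eq_add` —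
  **`corank ker(ψ^p − 1) = corank ker(ψ − 1) + corank ker(∑_{i<p} ψ^i)`** when `ker(ψ^p − 1)` has finite `p`-torsion: on
  `A = ker(ψ^p − 1)` the restriction `σ` of `ψ` has `σ^p = 1`, and the tree's quasi-isomorphism `A^σ × ker N_σ → A`
  (`fixedKerMap`, kernel and cokernel killed by `p`, `ZpCorankCyclotomicDivisibility`) is read back on `S`.
* §2 (Selmer; `φ = conj_γ|_{Sel_∞}`, `ψ = φ^{pⁿ}`) `toDual_cyclotomicFactor_smul` — `Ψ_{n+1} = ∑_{i<p} ((1+T)^{pⁿ})^i` acts as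
  `∑_{i<p} (φ^{pⁿ})^i`; `module_finite_int_quotient_cyclotomicFactor` (`Ψ_{n+1} ∣ ω_{n+1}`); ★★★ `zpCorank_selmerInvariants_succ_eq_add` —
  **`corank Sel_∞^{Γ_{n+1}} = corank Sel_∞^{Γ_n} + rank_{ℤ_p} X/Ψ_{n+1}X`**; ★★ `lambdaInvariant_layerQuotient_succ_eq_add` —
  **`rank X/ω_{n+1}X = rank X/ω_nX + rank X/Ψ_{n+1}X`** (no structure theory, no CRT).
* §3 (control, `W` elliptic) ★★ `selmerCorank_layer_succ_le` — **`corank Sel_{p^∞}(E_{K_{n+1}}/K_{n+1}) ≤ rank X/ω_nX + rank X/Ψ_{n+1}X`**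
  unconditionally; ★★★ `selmerCorank_layer_succ_eq_add_of_finite_kerG` — **the matching law: the Selmer corank JUMPS by exactly
  `rank_{ℤ_p} X/Ψ_{n+1}X` from `K_n` to `K_{n+1}`** as soon as `ker g_n` and `ker g_{n+1}` are finite (over `ℚ`: Lemma 3.4 at the two
  layers); `lambdaInvariant_cyclotomicFactor_pos_of_selmerCorank_layer_lt` — unconditionally, a Selmer corank at `K_{n+1}` exceeding
  `rank X/ω_nX` forces `rank X/Ψ_{n+1}X > 0`.

References: R. Greenberg, LNM 1716 (1999), §1 pp. 53, 60–65, §3 Lemmas 3.1–3.5, Thm. 1.2 [GreenbergLNM1716]; T. Dokchitser,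
V. Dokchitser, Ann. of Math. 172 (2010), Cor. 4.15 (proof) [DokchitserDokchitserAnnals2010]; L. Washington, GTM 83, §13.2
[Washington1997].
-/

set_option linter.dupNamespace false
set_option autoImplicit false

noncomputable section

open scoped Classical AddSubgroup TensorProduct

universe u

namespace Summit.BirchSwinnertonDyer.BirchSwinnertonDyer.Theorems.AlignedTransportAtTwoSelmerLayerSplit

open WeierstrassCurve Literature.NumberTheory.EllipticCurves Literature.NumberTheory.EllipticCurves.IwasawaDual
  Summit.BirchSwinnertonDyer.BirchSwinnertonDyer.Theorems.AlignedTransportAtTwoSelmerLayerModel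
  Summit.BirchSwinnertonDyer.BirchSwinnertonDyer.Theorems.AlignedTransportAtTwoSelmerLayerDuality
  Summit.BirchSwinnertonDyer.BirchSwinnertonDyer.Theorems.AlignedTransportAtTwoSelmerLayerControl

/-! ## §1 Pure algebra: `corank ker(ψ^p − 1) = corank ker(ψ − 1) + corank ker(N_ψ)` -/

section Generic

variable {S : Type u} [AddCommGroup S] (ψ : AddMonoid.End S) {p : ℕ} [hp : Fact p.Prime]

/-- `(ψ ^ k) (ψ s) = ψ ((ψ ^ k) s)` (powers commute with `ψ`, pointwise). [folklore] -/
theorem pow_apply_apply (k : ℕ) (s : S) : (ψ ^ k) (ψ s) = ψ ((ψ ^ k) s) := by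
  change (ψ ^ k * ψ) s = (ψ * ψ ^ k) s
  rw [← pow_succ, ← pow_succ']

omit hp in
/-- `ψ` preserves `ker(ψ^p − 1)`. [folklore] -/
theorem apply_mem_endInvariants_pow_sub_one {s : S} (hs : s ∈ endInvariants (ψ ^ p - 1)) :
    ψ s ∈ endInvariants (ψ ^ p - 1) := by
  rw [mem_endInvariants_iff] at hs ⊢
  change (ψ ^ p) (ψ s) - ψ s = 0
  change (ψ ^ p) s - s = 0 at hs
  rw [pow_apply_apply, ← map_sub, hs, map_zero]

omit hp in
/-- `ker(∑_{i<p} ψ^i) ⊆ ker(ψ^p − 1)` (`ψ^p − 1 = (ψ − 1)·N_ψ`). [folklore] -/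
theorem mem_endInvariants_pow_sub_one_of_mem_norm {s : S} (hs : s ∈ endInvariants (∑ i ∈ Finset.range p, ψ ^ i)) :
    s ∈ endInvariants (ψ ^ p - 1) := by
  rw [mem_endInvariants_iff] at hs ⊢
  rw [← mul_geom_sum ψ p]
  change (ψ - 1) ((∑ i ∈ Finset.range p, ψ ^ i) s) = 0
  rw [hs, map_zero]

omit hp in
/-- `ker(ψ − 1) ⊆ ker(ψ^p − 1)`. [folklore] -/
theorem mem_endInvariants_pow_sub_one_of_mem_sub_one {s : S} (hs : s ∈ endInvariants (ψ - 1)) :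
    s ∈ endInvariants (ψ ^ p - 1) := by
  rw [mem_endInvariants_iff] at hs ⊢
  rw [← geom_sum_mul ψ p]
  change (∑ i ∈ Finset.range p, ψ ^ i) ((ψ - 1) s) = 0
  rw [hs, map_zero]

/-- ★★ **`corank ker(ψ^p − 1) = corank ker(ψ − 1) + corank ker(∑_{i<p} ψ^i)`** for an endomorphism `ψ` of a `p`-primary abelian group
whose `ker(ψ^p − 1)` has finite `p`-torsion: on `A = ker(ψ^p − 1)` the restriction `σ` of `ψ` satisfies `σ^p = 1`, the tree's map
`A^σ × ker N_σ → A` (`fixedKerMap`) has kernel and cokernel killed by `p` (`nsmul_eq_zero_of_fixedKerMap_eq_zero`,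
`nsmul_mem_range_fixedKerMap`), and `A^σ = ker(ψ − 1)`, `ker N_σ = ker(∑ ψ^i)` as subgroups of `S`.
[cite: DokchitserDokchitserAnnals2010, Cor. 4.15 (proof)] [cite: GreenbergLNM1716, §3 p. 85] -/
theorem zpCorank_endInvariants_pow_sub_one_eq_add (hS : ∀ s : S, ∃ k : ℕ, p ^ k • s = 0)
    [Finite (↥(endInvariants (ψ ^ p - 1)))[(p : ℤ)]] :
    zpCorank ↥(endInvariants (ψ ^ p - 1)) p =
      zpCorank ↥(endInvariants (ψ - 1)) p + zpCorank ↥(endInvariants (∑ i ∈ Finset.range p, ψ ^ i)) p := by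
  set A : AddSubgroup S := endInvariants (ψ ^ p - 1) with hAdef
  have hA : ∀ a : ↥A, ∃ k : ℕ, p ^ k • a = 0 := fun a ↦ by
    obtain ⟨k, hk⟩ := hS (a : S)
    exact ⟨k, Subtype.ext (by rw [AddSubgroupClass.coe_nsmul, hk]; rfl)⟩
  have memA : ∀ s : S, s ∈ A ↔ (ψ ^ p) s = s := fun s ↦ by
    rw [hAdef, mem_endInvariants_iff]; change (ψ ^ p) s - s = 0 ↔ _; exact sub_eq_zero
  -- the restriction `σ` of `ψ` to `A`, `σ^p = 1`
  let σ : AddMonoid.End ↥A := ((ψ : S →+ S).comp A.subtype).codRestrict A fun a ↦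
    apply_mem_endInvariants_pow_sub_one ψ a.2
  have hσ : ∀ a : ↥A, ((σ a : ↥A) : S) = ψ a := fun _ ↦ rfl
  have hσk : ∀ (k : ℕ) (a : ↥A), (((σ ^ k) a : ↥A) : S) = (ψ ^ k) a := fun k ↦ by
    induction k with
    | zero => intro a; rw [pow_zero, pow_zero]; rfl
    | succ k ih => intro a; rw [pow_succ, pow_succ, AddMonoid.End.coe_mul, AddMonoid.End.coe_mul, Function.comp_apply,
        Function.comp_apply, ih, hσ]
  have hσp : σ ^ p = 1 := by
    refine AddMonoidHom.ext fun a ↦ Subtype.ext ?_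
    exact (hσk p a).trans ((memA _).mp a.2)
  -- finite `p`-torsion of the pieces
  obtain ⟨hF, hFfin⟩ := primary_and_finite_torsionBy_of_injective (i := (fixedSub σ).subtype) Subtype.val_injective hA
  obtain ⟨hB, hBfin⟩ := primary_and_finite_torsionBy_of_injective (i := (kerNorm σ p).subtype) Subtype.val_injective hA
  haveI := hFfin
  haveI := hBfin
  obtain ⟨hFB, hFBfin⟩ := primary_and_finite_torsionBy_of_shortExact
    (i := AddMonoidHom.inl ↥(fixedSub σ) ↥(kerNorm σ p)) (f := AddMonoidHom.snd ↥(fixedSub σ) ↥(kerNorm σ p))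
    (fun a b h ↦ (Prod.ext_iff.mp h).1)
    (fun x hx ↦ ⟨x.1, Prod.ext rfl (by change (0 : ↥(kerNorm σ p)) = x.2; exact (hx : x.2 = 0).symm)⟩)
    (fun _ ↦ rfl) hF hB
  haveI := hFBfin
  -- `corank A = corank A^σ + corank ker N_σ`
  have h1 : zpCorank (↥(fixedSub σ) × ↥(kerNorm σ p)) p = zpCorank ↥A p :=
    zpCorank_eq_of_nsmul_ker_of_nsmul_coker (fixedKerMap σ p) hFB hA hp.out.ne_zero
      nsmul_eq_zero_of_fixedKerMap_eq_zero (nsmul_mem_range_fixedKerMap hσp)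
  have h2 : zpCorank (↥(fixedSub σ) × ↥(kerNorm σ p)) p = zpCorank ↥(fixedSub σ) p + zpCorank ↥(kerNorm σ p) p :=
    zpCorank_prod hF hB
  -- `A^σ ≃+ ker(ψ − 1)` and `ker N_σ ≃+ ker(∑ ψ^i)` (same underlying elements of `S`)
  have memF : ∀ s : S, s ∈ endInvariants (ψ - 1) ↔ ψ s = s := fun s ↦ by
    rw [mem_endInvariants_iff]; change ψ s - s = 0 ↔ _; exact sub_eq_zero
  have hnorm : ∀ a : ↥A, ((normEnd σ p a : ↥A) : S) = (∑ i ∈ Finset.range p, ψ ^ i) (a : S) := fun a ↦ by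
    rw [normEnd_apply, AddSubmonoidClass.coe_finsetSum, addMonoidEnd_sum_apply]
    exact Finset.sum_congr rfl fun i _ ↦ hσk i a
  let eF : ↥(fixedSub σ) ≃+ ↥(endInvariants (ψ - 1)) :=
    { toFun := fun x ↦ ⟨((x : ↥A) : S), (memF _).mpr (by
        have hx := (mem_fixedSub_iff σ (x : ↥A)).mp x.2
        rw [← hσ, hx])⟩
      invFun := fun s ↦ ⟨⟨(s : S), mem_endInvariants_pow_sub_one_of_mem_sub_one ψ s.2⟩,
        (mem_fixedSub_iff σ _).mpr (Subtype.ext ((memF _).mp s.2))⟩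
      left_inv := fun x ↦ Subtype.ext (Subtype.ext rfl)
      right_inv := fun s ↦ Subtype.ext rfl
      map_add' := fun x y ↦ Subtype.ext rfl }
  let eB : ↥(kerNorm σ p) ≃+ ↥(endInvariants (∑ i ∈ Finset.range p, ψ ^ i)) :=
    { toFun := fun x ↦ ⟨((x : ↥A) : S), (mem_endInvariants_iff _ _).mpr (by
        rw [← hnorm, (mem_kerNorm_iff σ (x : ↥A)).mp x.2]; rfl)⟩
      invFun := fun s ↦ ⟨⟨(s : S), mem_endInvariants_pow_sub_one_of_mem_norm ψ s.2⟩,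
        (mem_kerNorm_iff σ _).mpr (Subtype.ext (by
          rw [hnorm]; exact (mem_endInvariants_iff _ _).mp s.2))⟩
      left_inv := fun x ↦ Subtype.ext (Subtype.ext rfl)
      right_inv := fun s ↦ Subtype.ext rfl
      map_add' := fun x y ↦ Subtype.ext rfl }
  rw [← zpCorank_congr eF p, ← zpCorank_congr eB p, ← h2, h1]

end Generic

/-! ## §2 The layer split on `Sel_∞` and on the dual side -/

section Selmer

variable {K : Type u} [Field K] [NumberField K] (W : WeierstrassCurve K) {p : ℕ} [hp : Fact p.Prime]
  (κ : ZpExtension K p) {γ : Field.absoluteGaloisGroup K}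

/-- **`Ψ_{n+1} = ∑_{i<p} ((1+T)^{pⁿ})^i` acts on `X` as `∑_{i<p} (φ^{pⁿ})^i` on `Sel_∞`** (`(1+T)^k` acts as `φ^k`,
`IsDualPair.toDual_one_add_X_pow_smul`). [cite: GreenbergLNM1716, §1 p. 53] -/
theorem toDual_cyclotomicFactor_smul (hγ : κ.IsTopGenerator γ) (D : W.SelmerDualData κ γ) (n : ℕ) (x : D.X)
    (s : W.selmerInfty κ) :
    D.toDual ((∑ i ∈ Finset.range p, ((1 + PowerSeries.X : PowerSeries ℤ_[p]) ^ (p ^ n)) ^ i : IwasawaAlgebra p) • x) s =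
      D.toDual x ((∑ i ∈ Finset.range p, ((W.conjSelmerInfty κ γ) ^ (p ^ n)) ^ i) s) := by
  rw [Finset.sum_smul, map_sum, AddMonoidHom.finsetSum_apply, addMonoidEnd_sum_apply, map_sum]
  refine Finset.sum_congr rfl fun i _ ↦ ?_
  rw [← pow_mul, ← pow_mul]
  exact (D.isDualPair W hγ).toDual_one_add_X_pow_smul (p ^ n * i) x s

/-- **`Λ/(Ψ_{n+1})` is `ℤ_p`-finite**: `ω_{n+1} = ω_n · Ψ_{n+1}` (`geom_sum_mul`), so `Λ/(Ψ_{n+1})` is a quotient of the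
`ℤ_p`-finite `Λ/(ω_{n+1})` (`…SelmerLayerDuality.module_finite_int_quotient_omega`). [cite: Washington1997, §13.2 (Prop. 13.8)] -/
theorem module_finite_int_quotient_cyclotomicFactor (n : ℕ) :
    Module.Finite ℤ_[p] (IwasawaAlgebra p ⧸
      Ideal.span {(∑ i ∈ Finset.range p, ((1 + PowerSeries.X : PowerSeries ℤ_[p]) ^ (p ^ n)) ^ i : IwasawaAlgebra p)}) := by
  have hle : Ideal.span {((1 + PowerSeries.X : PowerSeries ℤ_[p]) ^ (p ^ (n + 1)) - 1 : IwasawaAlgebra p)} ≤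
      Ideal.span {(∑ i ∈ Finset.range p, ((1 + PowerSeries.X : PowerSeries ℤ_[p]) ^ (p ^ n)) ^ i : IwasawaAlgebra p)} := by
    rw [Ideal.span_singleton_le_span_singleton]
    refine ⟨((1 + PowerSeries.X : PowerSeries ℤ_[p]) ^ (p ^ n)) - 1, ?_⟩
    rw [geom_sum_mul, ← pow_mul, ← pow_succ]
  haveI := module_finite_int_quotient_omega p (n + 1)
  refine Module.Finite.of_surjective (Ideal.Quotient.factorₐ ℤ_[p] hle).toLinearMap fun q ↦ ?_
  obtain ⟨a, rfl⟩ := Ideal.Quotient.mk_surjective q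
  exact ⟨Ideal.Quotient.mk _ a, rfl⟩

/-- ★★★ **THE LAYER SPLIT: `corank_{ℤ_p} Sel_∞^{Γ_{n+1}} = corank_{ℤ_p} Sel_∞^{Γ_n} + rank_{ℤ_p} X/Ψ_{n+1}X`** for every number field
`K`, every `ℤ_p`-extension `κ` with topological generator `γ`, every dual datum with `X` finitely generated, every `n`
(§1 at `ψ = φ^{pⁿ}` on `Sel_∞`, transported along `…SelmerLayerDuality.exists_addEquiv_selmerInvariants_endInvariants` and the
Pontryagin pair `(Ψ_{n+1}, ∑ (φ^{pⁿ})^i)`). [cite: GreenbergLNM1716, §1 p. 65 and §3 p. 85] [cite: DokchitserDokchitserAnnals2010, Cor. 4.15] -/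
theorem zpCorank_selmerInvariants_succ_eq_add (hγ : κ.IsTopGenerator γ) (D : W.SelmerDualData κ γ)
    [Module.Finite (IwasawaAlgebra p) D.X] (n : ℕ) :
    zpCorank ↥(W.selmerInfty κ ⊓ W.layerInvariants κ (n + 1)) p =
      zpCorank ↥(W.selmerInfty κ ⊓ W.layerInvariants κ n) p +
        lambdaInvariant p (D.X ⧸ (Ideal.span
          {(∑ i ∈ Finset.range p, ((1 + PowerSeries.X : PowerSeries ℤ_[p]) ^ (p ^ n)) ^ i : IwasawaAlgebra p)} •
            ⊤ : Submodule (IwasawaAlgebra p) D.X)) := by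
  obtain ⟨e1, -⟩ := exists_addEquiv_selmerInvariants_endInvariants W κ hγ (n + 1)
  obtain ⟨e0, -⟩ := exists_addEquiv_selmerInvariants_endInvariants W κ hγ n
  rw [zpCorank_congr e1 p, zpCorank_congr e0 p,
    ← zpCorank_endInvariants_eq_lambdaInvariant_quotient p W κ hγ D (toDual_cyclotomicFactor_smul W κ hγ D n)
      (module_finite_int_quotient_cyclotomicFactor n)]
  have hS : ∀ s : W.selmerInfty κ, ∃ k : ℕ, p ^ k • s = 0 := fun s ↦ by
    obtain ⟨k, hk⟩ := W.exists_pow_smul_subgroupH1_ker_eq_zero κ (s : W.subgroupH1 p κ.kerSubgroup)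
    exact ⟨k, Subtype.ext (by rw [AddSubgroupClass.coe_nsmul, hk]; rfl)⟩
  have e : (W.conjSelmerInfty κ γ) ^ (p ^ (n + 1)) - 1 = ((W.conjSelmerInfty κ γ) ^ (p ^ n)) ^ p - 1 := by
    rw [← pow_mul, ← pow_succ]
  haveI : Finite (↥(endInvariants (((W.conjSelmerInfty κ γ) ^ (p ^ n)) ^ p - 1)))[(p : ℤ)] := by
    rw [← e]
    haveI := finite_torsionBy_selmerInvariants W κ hγ D (n + 1)
    obtain ⟨h1, h2⟩ := primary_and_finite_torsionBy_of_injective (i := e1.symm.toAddMonoidHom)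
      e1.symm.injective (fun a ↦ by
        obtain ⟨k, hk⟩ := W.exists_pow_smul_subgroupH1_ker_eq_zero κ (a : W.subgroupH1 p κ.kerSubgroup)
        exact ⟨k, Subtype.ext (by rw [AddSubgroupClass.coe_nsmul, hk]; rfl)⟩)
    exact h2
  rw [e]
  exact zpCorank_endInvariants_pow_sub_one_eq_add ((W.conjSelmerInfty κ γ) ^ (p ^ n)) hS

/-- ★★ **`rank_{ℤ_p} X/ω_{n+1}X = rank_{ℤ_p} X/ω_nX + rank_{ℤ_p} X/Ψ_{n+1}X`** (any `X = D.X` finitely generated; the `ℤ_p`-rank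
count of `Λ/ω_{n+1} ∼ Λ/ω_n ⊕ Λ/Ψ_{n+1}` WITHOUT the structure theorem: §2 read through `…SelmerLayerDuality`).
[cite: Washington1997, §13.2] [cite: GreenbergLNM1716, §1 p. 65] -/
theorem lambdaInvariant_layerQuotient_succ_eq_add (hγ : κ.IsTopGenerator γ) (D : W.SelmerDualData κ γ)
    [Module.Finite (IwasawaAlgebra p) D.X] (n : ℕ) :
    lambdaInvariant p (D.X ⧸ (Ideal.span {((1 + PowerSeries.X : PowerSeries ℤ_[p]) ^ (p ^ (n + 1)) - 1 : IwasawaAlgebra p)} •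
        ⊤ : Submodule (IwasawaAlgebra p) D.X)) =
      lambdaInvariant p (D.X ⧸ (Ideal.span {((1 + PowerSeries.X : PowerSeries ℤ_[p]) ^ (p ^ n) - 1 : IwasawaAlgebra p)} •
        ⊤ : Submodule (IwasawaAlgebra p) D.X)) +
        lambdaInvariant p (D.X ⧸ (Ideal.span
          {(∑ i ∈ Finset.range p, ((1 + PowerSeries.X : PowerSeries ℤ_[p]) ^ (p ^ n)) ^ i : IwasawaAlgebra p)} •
            ⊤ : Submodule (IwasawaAlgebra p) D.X)) := by
  rw [← zpCorank_selmerInvariants_eq_lambdaInvariant_layerQuotient p W κ hγ D (n + 1),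
    ← zpCorank_selmerInvariants_eq_lambdaInvariant_layerQuotient p W κ hγ D n]
  exact zpCorank_selmerInvariants_succ_eq_add W κ hγ D n

end Selmer

/-! ## §3 The layer-`n` matching law in corank form -/

section Control

variable {K : Type u} [Field K] [NumberField K] (W : WeierstrassCurve K) [W.IsElliptic] {p : ℕ} [hp : Fact p.Prime]
  (κ : ZpExtension K p) {γ : Field.absoluteGaloisGroup K}

/-- ★★ **`corank_{ℤ_p} Sel_{p^∞}(E_{K_{n+1}}/K_{n+1}) ≤ rank_{ℤ_p} X/ω_nX + rank_{ℤ_p} X/Ψ_{n+1}X` UNCONDITIONALLY** (Lemma 3.1 at layer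
`n+1`, `…SelmerLayerControl`, and the split). [cite: GreenbergLNM1716, §3 Lemma 3.1, Thm 1.9] -/
theorem selmerCorank_layer_succ_le (hγ : κ.IsTopGenerator γ) (D : W.SelmerDualData κ γ)
    [Module.Finite (IwasawaAlgebra p) D.X] (n : ℕ) :
    (W.baseChange (κ.layer (n + 1))).selmerCorank p ≤
      lambdaInvariant p (D.X ⧸ (Ideal.span {((1 + PowerSeries.X : PowerSeries ℤ_[p]) ^ (p ^ n) - 1 : IwasawaAlgebra p)} •
        ⊤ : Submodule (IwasawaAlgebra p) D.X)) +
        lambdaInvariant p (D.X ⧸ (Ideal.span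
          {(∑ i ∈ Finset.range p, ((1 + PowerSeries.X : PowerSeries ℤ_[p]) ^ (p ^ n)) ^ i : IwasawaAlgebra p)} •
            ⊤ : Submodule (IwasawaAlgebra p) D.X)) := by
  rw [← lambdaInvariant_layerQuotient_succ_eq_add W κ hγ D n]
  exact selmerCorank_layer_le_lambdaInvariant_layerQuotient W κ hγ D (n + 1)

/-- ★★★ **THE LAYER-`n` MATCHING LAW (corank form): `corank Sel_{p^∞}(E_{K_{n+1}}/K_{n+1}) = corank Sel_{p^∞}(E_{K_n}/K_n) +
rank_{ℤ_p} X/Ψ_{n+1}X` as soon as Greenberg's `ker g_n` and `ker g_{n+1}` are finite** — the Selmer corank jumps between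
consecutive layers by EXACTLY the `ℤ_p`-rank of `X/Ψ_{n+1}X` (Ш-inclusive, every prime `p`, every number field; over `ℚ` the
inputs are Lemma 3.4 at the layers `n`, `n+1`). [cite: GreenbergLNM1716, Thm 1.2 and §1 p. 65] -/
theorem selmerCorank_layer_succ_eq_add_of_finite_kerG (hγ : κ.IsTopGenerator γ) (D : W.SelmerDualData κ γ)
    [Module.Finite (IwasawaAlgebra p) D.X] (n : ℕ) [Finite (W.KerG κ n)] [Finite (W.KerG κ (n + 1))] :
    (W.baseChange (κ.layer (n + 1))).selmerCorank p =
      (W.baseChange (κ.layer n)).selmerCorank p +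
        lambdaInvariant p (D.X ⧸ (Ideal.span
          {(∑ i ∈ Finset.range p, ((1 + PowerSeries.X : PowerSeries ℤ_[p]) ^ (p ^ n)) ^ i : IwasawaAlgebra p)} •
            ⊤ : Submodule (IwasawaAlgebra p) D.X)) := by
  rw [selmerCorank_layer_eq_lambdaInvariant_layerQuotient_of_finite_kerG W κ hγ D (n + 1),
    selmerCorank_layer_eq_lambdaInvariant_layerQuotient_of_finite_kerG W κ hγ D n]
  exact lambdaInvariant_layerQuotient_succ_eq_add W κ hγ D n

/-- **Unconditional growth certificate**: if `corank Sel_{p^∞}(E_{K_{n+1}}/K_{n+1}) > rank_{ℤ_p} X/ω_nX` then `rank_{ℤ_p} X/Ψ_{n+1}X > 0`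
(the `Ψ_{n+1}`-part of `X` is seen by the Selmer group of the layer `K_{n+1}`; Lemma 3.1 only). [cite: GreenbergLNM1716, §3 Lemma 3.1] -/
theorem lambdaInvariant_cyclotomicFactor_pos_of_selmerCorank_layer_lt (hγ : κ.IsTopGenerator γ) (D : W.SelmerDualData κ γ)
    [Module.Finite (IwasawaAlgebra p) D.X] (n : ℕ)
    (h : lambdaInvariant p (D.X ⧸ (Ideal.span {((1 + PowerSeries.X : PowerSeries ℤ_[p]) ^ (p ^ n) - 1 : IwasawaAlgebra p)} •
        ⊤ : Submodule (IwasawaAlgebra p) D.X)) < (W.baseChange (κ.layer (n + 1))).selmerCorank p) :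
    0 < lambdaInvariant p (D.X ⧸ (Ideal.span
          {(∑ i ∈ Finset.range p, ((1 + PowerSeries.X : PowerSeries ℤ_[p]) ^ (p ^ n)) ^ i : IwasawaAlgebra p)} •
            ⊤ : Submodule (IwasawaAlgebra p) D.X)) := by
  have := selmerCorank_layer_succ_le W κ hγ D n
  omega

end Control

end Summit.BirchSwinnertonDyer.BirchSwinnertonDyer.Theorems.AlignedTransportAtTwoSelmerLayerSplit

end
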